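import Literature.NumberTheory.EllipticCurves.BinaryQuarticTwoCoverings
import Literature.NumberTheory.EllipticCurves.H1UnramifiedFinite
import HarnessLib

/-!
# Two-coverings attached to binary quartic forms, II: the Galois cocycle `σ ↦ T(r₀, σ r₀)` and
# its class in `H¹(K, E[2])`

Topic `Literature/NumberTheory/EllipticCurves`. Second file of the theory proving the named fact
`Literature.NumberTheory.EllipticCurves.bhargavaShankar_card_selmerTwo_eq_kEquivClassCount`
(`BinaryQuarticMinimisation.lean`; Bhargava–Shankar 2015, held arXiv text §5.1, Lemma 5.2: the
`2`-Selmer group of `E_{A,B}` is in bijection with the classes of locally soluble binary quartic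
forms with invariants `λ⁴I(E)`, `λ⁶J(E)`).

Let `K` be a field, `Ω ⊇ K` a field (an algebraic closure), `g` a binary quartic form over `K`
with `a ≠ 0`, `Δ ≠ 0` and invariants `I(g) = −3At⁴`, `J(g) = −27Bt⁶` (`t ∈ Kˣ`), and `r₀ ∈ Ω` a
root of `g(x, 1)`. With the torsor difference `T(u, v) ∈ E_{A,B}(Ω)[2]` of
`BinaryQuarticTwoCoverings.lean` (file I), this file proves:

* `TwoCovering.cocycleFun`: the map `σ ↦ T(r₀, σ r₀)` on `Gal(Ω/K) = Ω ≃ₐ[K] Ω` is a crossed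
  homomorphism, `T(r₀, στ r₀) = T(r₀, σ r₀) + σ·T(r₀, τ r₀)` (`cocycleFun_mul`), with values in
  `E[2]` (`cocycleFun_add_self`), continuous for the Krull topology (`continuous_cocycleFun`: it
  factors through `σ ↦ σ r₀`, which is locally constant since `Gal(Ω/K(r₀))` is open), and
  changing the root changes it by the coboundary of `T(r₀, r₁)` (`cocycleFun_changeRoot`)
  (Cremona, *Classical invariants and 2-descent on elliptic curves*, J. Symbolic Comput. 31 (2001),
  Prop. 4.3 (3) and §5: `θ^σ = θ + T_σ`, "the map `σ ↦ T_σ` … is a cocycle, representing an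
  element of `H¹(Gal(K̄/K), E[2])` …; changing `θ` … replaces `T_σ` by a cohomologous cocycle");
* over `K = ℚ`, `Ω = ℚ̄`: the packaging `TwoCovering.selmerCocycle` of this cocycle as a
  continuous `1`-cocycle of `Γ_ℚ` with values in the tree's Galois module
  `geomTorsion (shortWeierstrass AB) 2 = E_{A,B}(ℚ̄)[2]`, its class
  `TwoCovering.selmerClass ∈ H¹(ℚ, E[2]) = galH1Torsion _ 2` (Mathlib's continuous cohomology, via
  `Literature.NumberTheory.GaloisRepresentations.oneCocycleClass`), independence of the root
  (`selmerClass_changeRoot`), and the **cocycle form of the local conditions**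
  (`selmerClass_mem_selmerLocalKer_iff`): the class dies in `H¹(K_v, E(K̄_v))` iff the *same*
  cocycle formed over `K_v` with the root `ι r₀` (`ι : ℚ̄ → K̄_v` the chosen embedding) is
  principal, `∃ P ∈ E(K̄_v), ∀ σ ∈ Γ_{K_v}, T(ι r₀, σ ι r₀) = σP − P`.

The sequel files prove that the class depends only on the `ℚ`-equivalence class of `g`, that it
is principal over `K_v` iff `g` is `K_v`-soluble, and the surjectivity onto the Selmer group.

## References

* J. E. Cremona, *Classical invariants and 2-descent on elliptic curves*, J. Symbolic Comput. 31
  (2001) 71–87, Prop. 4.3 and §5. [Cremona2001]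
* M. Bhargava, A. Shankar, Ann. of Math. (2) 181 (2015), §5.1 of arXiv:1006.1002v2, Lemma 5.2.
  [BhargavaShankarAnnals2015]
* J.-P. Serre, *Galois Cohomology*, I.§2 and I.§5.1 (crossed homomorphisms, compatible pairs).

## Design

* The general part is stated for a base ring `R₀` of the curve `W`, a field `K`, an extension
  field `Ω` (`R₀ → K → Ω` a scalar tower) and the group `Ω ≃ₐ[K] Ω`; the action of `σ` on
  `E(Ω) = (W ⁄ Ω).Point` is `Point.map ψ` for any `R₀`-algebra map `ψ` agreeing with `σ`
  (`ψ = σ` for the tree's `geomPoints`, `ψ = σ.restrictScalars ℚ` for its `localPoints`).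
* Hypotheses on the quartic are bundled in `TwoCovering.Setup` (data: `A B t`; proofs:
  `a ≠ 0`, `t ≠ 0`, `I = −3At⁴`, `J = −27Bt⁶`, `4A³ + 27B² ≠ 0`), from which `Δ(g) ≠ 0`.
-/

noncomputable section

open scoped Classical

universe u

namespace Literature.NumberTheory.EllipticCurves

namespace TwoCovering

open BinaryQuartic WeierstrassCurve WeierstrassCurve.Affine GaloisRepresentations

/-! ## §1 Set-up: a quartic in the `E_{A,B}`-family -/

section Setup

variable {K : Type*} [Field K]

/-- The standing hypotheses on a binary quartic form `g` over `K` attached to `E_{A,B}`: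
`a ≠ 0`, a scalar `t ≠ 0` with `I(g) = −3At⁴`, `J(g) = −27Bt⁶`, and `4A³ + 27B² ≠ 0`
(Bhargava–Shankar, §5.1: forms with invariants `λ⁴I(E)`, `λ⁶J(E)`, `I(E) = −3A`, `J(E) = −27B`;
here `λ = t`). [cite: BhargavaShankarAnnals2015, §5.1 and Lemma 5.2 (arXiv:1006.1002v2 numbering)] -/
structure Setup (g : BinaryQuartic K) (A B t : K) : Prop where
  /-- no root at infinity -/
  a_ne : g.a ≠ 0
  /-- the scalar is nonzero -/
  t_ne : t ≠ 0
  /-- `I(g) = −3At⁴` -/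
  I_eq : g.I = -3 * A * t ^ 4
  /-- `J(g) = −27Bt⁶` -/
  J_eq : g.J = -27 * B * t ^ 6
  /-- `E_{A,B}` is an elliptic curve -/
  disc_ne : 4 * A ^ 3 + 27 * B ^ 2 ≠ 0

namespace Setup

variable {g : BinaryQuartic K} {A B t : K} (h : Setup g A B t)
include h

/-- `Δ(g) = −t¹²(4A³ + 27B²)` (from `27Δ = 4I³ − J²`), valid when `27 ≠ 0`. [folklore] -/
theorem disc_eq (h27 : (27 : K) ≠ 0) : g.disc = -(t ^ 12 * (4 * A ^ 3 + 27 * B ^ 2)) := by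
  have h0 := twentySeven_mul_disc g
  rw [h.I_eq, h.J_eq] at h0
  apply mul_left_cancel₀ h27
  linear_combination h0

/-- `Δ(g) ≠ 0` (in characteristic `0`). [folklore] -/
theorem disc_ne_zero [CharZero K] : g.disc ≠ 0 := by
  rw [h.disc_eq (by norm_num)]
  exact neg_ne_zero.mpr (mul_ne_zero (pow_ne_zero _ h.t_ne) h.disc_ne)

/-- The set-up is preserved by field homomorphisms. [folklore] -/
theorem map {L : Type*} [Field L] (ψ : K →+* L) : Setup (g.map ψ) (ψ A) (ψ B) (ψ t) where
  a_ne := by simpa using h.a_ne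
  t_ne := (map_ne_zero ψ).mpr h.t_ne
  I_eq := by rw [I_map, h.I_eq]; simp [map_ofNat]
  J_eq := by rw [J_map, h.J_eq]; simp [map_ofNat]
  disc_ne := by
    have := (map_ne_zero ψ).mpr h.disc_ne
    simpa [map_ofNat] using this

end Setup

end Setup

/-! ## §2 The crossed homomorphism `σ ↦ T(r₀, σ r₀)` -/

section General

variable {R₀ K Ω : Type*} [CommRing R₀] [Field K] [Field Ω] [Algebra R₀ Ω] [Algebra K Ω]

variable (W : WeierstrassCurve R₀) (g : BinaryQuartic K) (t : K) (r₀ : Ω)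

/-- **The cocycle of a binary quartic** (as a bare function): `σ ↦ T(r₀, σ r₀) ∈ E(Ω)`, the
torsor difference of the root `r₀` of `g(x,1)` and its conjugate, computed on `E ⁄ Ω` from
`g ⊗ Ω` and `t` (Cremona 2001, Prop. 4.3 (3): `T_σ = θ^σ(R) − θ(R)`, evaluated at the
ramification point `R = (r₀, 0)` where `θ(R) = O`). [cite: Cremona2001, Prop. 4.3 (3) and §5] -/
def cocycleFun (σ : Ω ≃ₐ[K] Ω) : (W.baseChange Ω).toAffine.Point :=
  torsorPt (W.baseChange Ω).toAffine (g.map (algebraMap K Ω)) (algebraMap K Ω t) r₀ (σ r₀)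

/-- Unfolding `cocycleFun`. [folklore] -/
theorem cocycleFun_apply (σ : Ω ≃ₐ[K] Ω) : cocycleFun W g t r₀ σ =
    torsorPt (W.baseChange Ω).toAffine (g.map (algebraMap K Ω)) (algebraMap K Ω t) r₀ (σ r₀) :=
  rfl

/-- The cocycle vanishes at `1`. [folklore] -/
@[simp] theorem cocycleFun_one : cocycleFun W g t r₀ 1 = 0 := by
  rw [cocycleFun_apply, AlgEquiv.one_apply, torsorPt_self]

variable {W g t r₀}

/-- A `K`-automorphism of `Ω` fixes the base-changed form `g ⊗ Ω`; here `ψ` is any `R₀`-algebra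
map agreeing with `σ`. [folklore] -/
theorem map_map_algebraMap (ψ : Ω →ₐ[R₀] Ω) (σ : Ω ≃ₐ[K] Ω) (hψ : ∀ x, ψ x = σ x) :
    (g.map (algebraMap K Ω)).map (ψ : Ω →+* Ω) = g.map (algebraMap K Ω) := by
  ext <;> simp [BinaryQuartic.map, hψ]

/-- A `K`-automorphism of `Ω` permutes the roots of `g(x, 1)` in `Ω`. [folklore] -/
theorem eval_apply_eq_zero (σ : Ω ≃ₐ[K] Ω) {u : Ω} (hu : (g.map (algebraMap K Ω)).eval u 1 = 0) :
    (g.map (algebraMap K Ω)).eval (σ u) 1 = 0 := by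
  have key : (g.map (algebraMap K Ω)).eval (σ u) 1 = σ ((g.map (algebraMap K Ω)).eval u 1) := by
    simp [BinaryQuartic.eval, BinaryQuartic.map]
  rw [key, hu, map_zero]

/-- A root of `g ⊗ Ω` is one of the roots of any root data. [folklore] -/
theorem exists_eq_r (R : RootData (g.map (algebraMap K Ω))) (ha : g.a ≠ 0) {u : Ω}
    (hu : (g.map (algebraMap K Ω)).eval u 1 = 0) : ∃ i, u = R.r i :=
  (R.eval_eq_zero_iff' (by simpa using ha) u).mp hu

/-- **Galois equivariance of the torsor**: `σ(T(u, v)) = T(σu, σv)` for `σ ∈ Gal(Ω/K)` (the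
formulas defining `T` have coefficients in `K`). Here the action of `σ` on `E(Ω)` is `Point.map ψ`
for any `R₀`-algebra map `ψ` agreeing with `σ`. [folklore] -/
theorem map_torsorPt_eq (ψ : Ω →ₐ[R₀] Ω) (σ : Ω ≃ₐ[K] Ω) (hψ : ∀ x, ψ x = σ x) (u v : Ω) :
    Point.map ψ (torsorPt (W.baseChange Ω).toAffine (g.map (algebraMap K Ω)) (algebraMap K Ω t) u v) =
      torsorPt (W.baseChange Ω).toAffine (g.map (algebraMap K Ω)) (algebraMap K Ω t) (σ u) (σ v) := by
  rw [map_torsorPt W ψ, map_map_algebraMap ψ σ hψ]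
  simp [hψ]

variable {A B : K}

/-- **The cocycle identity** `T(r₀, στ r₀) = T(r₀, σ r₀) + σ·T(r₀, τ r₀)`: `σ ↦ T(r₀, σ r₀)` is a
crossed homomorphism `Gal(Ω/K) → E(Ω)` (Chasles' relation for the roots `r₀, σr₀, στr₀` and
Galois equivariance of `T`). Cremona 2001, §5: "the map `σ ↦ T_σ` used in the proof of
Proposition 4.3 is a cocycle". [cite: Cremona2001, §5 (σ ↦ T_σ is a cocycle) and Prop. 4.3 (3)] -/
theorem cocycleFun_mul [CharZero Ω] (h : Setup g A B t) (R : RootData (g.map (algebraMap K Ω)))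
    (hr₀ : (g.map (algebraMap K Ω)).eval r₀ 1 = 0) (ψ : Ω →ₐ[R₀] Ω) (σ τ : Ω ≃ₐ[K] Ω)
    (hψ : ∀ x, ψ x = σ x)
    (hC : IsShortModel (W.baseChange Ω).toAffine (algebraMap K Ω A) (algebraMap K Ω B)) :
    cocycleFun W g t r₀ (σ * τ) = cocycleFun W g t r₀ σ + Point.map ψ (cocycleFun W g t r₀ τ) := by
  have hΩ := h.map (algebraMap K Ω)
  obtain ⟨i, hi⟩ := exists_eq_r R h.a_ne hr₀
  obtain ⟨j, hj⟩ := exists_eq_r R h.a_ne (eval_apply_eq_zero σ hr₀)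
  obtain ⟨k, hk⟩ := exists_eq_r R h.a_ne (eval_apply_eq_zero σ (eval_apply_eq_zero τ hr₀))
  rw [cocycleFun_apply, cocycleFun_apply, cocycleFun_apply, map_torsorPt_eq ψ σ hψ,
    AlgEquiv.mul_apply, hk, hj, hi]
  exact (torsorPt_add_torsorPt hC R hΩ.a_ne (by norm_num) hΩ.disc_ne_zero hΩ.t_ne hΩ.I_eq
    hΩ.J_eq i j k).symm

/-- The cocycle takes values in `E[2]`: `T(r₀, σr₀) + T(r₀, σr₀) = O`. [folklore] -/
theorem cocycleFun_add_self (σ : Ω ≃ₐ[K] Ω)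
    (hC : IsShortModel (W.baseChange Ω).toAffine (algebraMap K Ω A) (algebraMap K Ω B)) :
    cocycleFun W g t r₀ σ + cocycleFun W g t r₀ σ = 0 :=
  torsorPt_add_self hC _ _ _ _

/-- **Change of root**: `T(r₁, σ r₁) = T(r₀, σ r₀) + (σ·T(r₀, r₁) − T(r₀, r₁))` for two roots
`r₀, r₁` — the cocycles attached to different roots differ by a coboundary (Cremona 2001, §5:
"This cocycle is independent of `R ∈ C(K̄)`; changing `θ` … has the effect of replacing the
cocycle `T_σ` by a cohomologous cocycle"). [cite: Cremona2001, §5 (independence of the choice of θ and R)] -/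
theorem cocycleFun_changeRoot [CharZero Ω] (h : Setup g A B t)
    (R : RootData (g.map (algebraMap K Ω))) {r₁ : Ω}
    (hr₀ : (g.map (algebraMap K Ω)).eval r₀ 1 = 0) (hr₁ : (g.map (algebraMap K Ω)).eval r₁ 1 = 0)
    (ψ : Ω →ₐ[R₀] Ω) (σ : Ω ≃ₐ[K] Ω) (hψ : ∀ x, ψ x = σ x)
    (hC : IsShortModel (W.baseChange Ω).toAffine (algebraMap K Ω A) (algebraMap K Ω B)) :
    cocycleFun W g t r₁ σ = cocycleFun W g t r₀ σ +
      (Point.map ψ (torsorPt (W.baseChange Ω).toAffine (g.map (algebraMap K Ω))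
          (algebraMap K Ω t) r₀ r₁) -
        torsorPt (W.baseChange Ω).toAffine (g.map (algebraMap K Ω)) (algebraMap K Ω t) r₀ r₁) := by
  have hΩ := h.map (algebraMap K Ω)
  set gΩ := g.map (algebraMap K Ω)
  set tΩ := algebraMap K Ω t
  obtain ⟨i, hi⟩ := exists_eq_r R h.a_ne hr₀
  obtain ⟨j, hj⟩ := exists_eq_r R h.a_ne hr₁
  obtain ⟨k, hk⟩ := exists_eq_r R h.a_ne (eval_apply_eq_zero σ hr₀)
  obtain ⟨l, hl⟩ := exists_eq_r R h.a_ne (eval_apply_eq_zero σ hr₁)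
  have chasles := fun i j k ↦ torsorPt_add_torsorPt hC R hΩ.a_ne (by norm_num) hΩ.disc_ne_zero
    hΩ.t_ne hΩ.I_eq hΩ.J_eq i j k
  rw [cocycleFun_apply, cocycleFun_apply, map_torsorPt_eq ψ σ hψ, hk, hl, hi, hj]
  -- `T(r_j, r_l) = T(r_j, r_i) + T(r_i, r_k) + T(r_k, r_l)` and `T` is `2`-torsion
  have h2 : torsorPt (W.baseChange Ω).toAffine gΩ tΩ (R.r i) (R.r j) =
      -torsorPt (W.baseChange Ω).toAffine gΩ tΩ (R.r i) (R.r j) := (neg_torsorPt hC _ _ _ _).symm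
  rw [sub_eq_add_neg, ← h2, ← chasles j i l, ← chasles i k l, torsorPt_comm gΩ tΩ (R.r j) (R.r i)]
  abel

/-! ### Continuity -/

/-- For `r₀` algebraic over `K` and `x ∈ Ω`, the set of `σ ∈ Gal(Ω/K)` with `σ r₀ = x` is open in
the Krull topology (a union of left cosets of the open subgroup `Gal(Ω/K(r₀))`). [folklore] -/
theorem isOpen_setOf_apply_eq (hint : IsIntegral K r₀) (x : Ω) :
    IsOpen {σ : Ω ≃ₐ[K] Ω | σ r₀ = x} := by
  let F : IntermediateField K Ω := IntermediateField.adjoin K {r₀}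
  haveI : FiniteDimensional K F := IntermediateField.adjoin.finiteDimensional hint
  have hopen : IsOpen (F.fixingSubgroup : Set (Ω ≃ₐ[K] Ω)) :=
    IntermediateField.fixingSubgroup_isOpen F
  rw [isOpen_iff_forall_mem_open]
  intro σ₀ hσ₀
  have hσ₀' : σ₀ r₀ = x := hσ₀
  refine ⟨(fun τ ↦ σ₀ * τ) '' (F.fixingSubgroup : Set (Ω ≃ₐ[K] Ω)), ?_,
    isOpenMap_mul_left σ₀ _ hopen, ⟨1, F.fixingSubgroup.one_mem, mul_one σ₀⟩⟩
  rintro _ ⟨τ, hτ, rfl⟩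
  show (σ₀ * τ) r₀ = x
  rw [SetLike.mem_coe, IntermediateField.mem_fixingSubgroup_iff] at hτ
  rw [AlgEquiv.mul_apply, hτ r₀ (IntermediateField.mem_adjoin_simple_self K r₀), hσ₀']

/-- A function of `σ r₀` (`r₀` algebraic over `K`) is continuous on `Gal(Ω/K)` for any discrete
target: it is locally constant. [folklore] -/
theorem continuous_apply_root {X : Type*} [TopologicalSpace X] [DiscreteTopology X]
    (hint : IsIntegral K r₀) (F : Ω → X) : Continuous fun σ : Ω ≃ₐ[K] Ω ↦ F (σ r₀) := by
  refine continuous_def.mpr fun s _ ↦ ?_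
  have : (fun σ : Ω ≃ₐ[K] Ω ↦ F (σ r₀)) ⁻¹' s = ⋃ x ∈ F ⁻¹' s, {σ : Ω ≃ₐ[K] Ω | σ r₀ = x} := by
    ext σ; simp
  rw [this]
  exact isOpen_biUnion fun x _ ↦ isOpen_setOf_apply_eq hint x

/-- A root of `g(x, 1)` in `Ω` is algebraic over `K` when `a ≠ 0`. [folklore] -/
theorem isIntegral_of_eval_eq_zero (ha : g.a ≠ 0) (hr₀ : (g.map (algebraMap K Ω)).eval r₀ 1 = 0) :
    IsIntegral K r₀ := by
  refine IsAlgebraic.isIntegral ⟨g.toPoly, fun h0 ↦ ha ?_, ?_⟩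
  · have := congrArg (Polynomial.coeff · 4) h0
    simpa [toPoly, Polynomial.coeff_X_pow] using this
  · simp only [BinaryQuartic.eval, BinaryQuartic.map_a, BinaryQuartic.map_b, BinaryQuartic.map_c,
      BinaryQuartic.map_d, BinaryQuartic.map_e, one_pow, mul_one] at hr₀
    simp [toPoly, Polynomial.aeval_def, Polynomial.eval₂_add, Polynomial.eval₂_mul, hr₀]

end General

/-! ## §3 Over `ℚ`: the class in `H¹(ℚ, E[2])` and the cocycle form of the local conditions -/

section Rat

open IsDedekindDomain NumberField

variable (AB : ℤ × ℤ) (g : BinaryQuartic ℚ) (t : ℚ) (r₀ : AlgebraicClosure ℚ)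

/-- The short model `E_{A,B} ⁄ Ω` for any `ℚ`-algebra field `Ω`. [folklore] -/
theorem isShortModel_ratCast (Ω : Type*) [Field Ω] [Algebra ℚ Ω] :
    IsShortModel ((shortWeierstrass AB).baseChange Ω).toAffine (algebraMap ℚ Ω (AB.1 : ℚ))
      (algebraMap ℚ Ω (AB.2 : ℚ)) := by
  simpa using isShortModel_baseChange AB Ω

/-- Membership in `E(F̄)[2]`: `P ∈ geomTorsion W 2 ↔ P + P = O`. [folklore] -/
theorem mem_geomTorsion_two_iff {F : Type u} [Field F] (W : WeierstrassCurve F) (P : geomPoints W) :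
    P ∈ geomTorsion W 2 ↔ P + P = 0 := by
  rw [geomTorsion, AddSubgroup.torsionBy, Submodule.mem_toAddSubgroup, Submodule.mem_torsionBy_iff,
    two_zsmul]

/-- The torsor difference `T(u, v)` of `g` over `ℚ̄`, as an element of the tree's Galois module
`geomPoints (shortWeierstrass AB) = E_{A,B}(ℚ̄)`. [folklore] -/
def geomTorsorPt (u v : AlgebraicClosure ℚ) : geomPoints (shortWeierstrass AB) :=
  torsorPt ((shortWeierstrass AB).baseChange (AlgebraicClosure ℚ)).toAffine
    (g.map (algebraMap ℚ _)) (algebraMap ℚ _ t) u v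

/-- Unfolding `geomTorsorPt`. [folklore] -/
theorem geomTorsorPt_eq (u v : AlgebraicClosure ℚ) : geomTorsorPt AB g t u v =
    torsorPt ((shortWeierstrass AB).baseChange (AlgebraicClosure ℚ)).toAffine
      (g.map (algebraMap ℚ _)) (algebraMap ℚ _ t) u v := rfl

/-- The cocycle `σ ↦ T(r₀, σ r₀)` of `g` over `ℚ̄`, valued in the Galois module `E_{A,B}(ℚ̄)`.
[folklore] -/
def geomCocycleFun (σ : Field.absoluteGaloisGroup ℚ) : geomPoints (shortWeierstrass AB) :=
  cocycleFun (shortWeierstrass AB) g t r₀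
    (show AlgebraicClosure ℚ ≃ₐ[ℚ] AlgebraicClosure ℚ from σ)

/-- Unfolding `geomCocycleFun`. [folklore] -/
theorem geomCocycleFun_eq (σ : Field.absoluteGaloisGroup ℚ) : geomCocycleFun AB g t r₀ σ =
    cocycleFun (shortWeierstrass AB) g t r₀
      (show AlgebraicClosure ℚ ≃ₐ[ℚ] AlgebraicClosure ℚ from σ) := rfl

/-- `geomCocycleFun σ = T(r₀, σ r₀)`. [folklore] -/
theorem geomCocycleFun_eq_geomTorsorPt (σ : Field.absoluteGaloisGroup ℚ) :
    geomCocycleFun AB g t r₀ σ =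
      geomTorsorPt AB g t r₀ ((show AlgebraicClosure ℚ ≃ₐ[ℚ] AlgebraicClosure ℚ from σ) r₀) := rfl

/-- The action of `Γ_ℚ` on `E(ℚ̄)` is `Point.map σ`, in the form consumed by the general lemmas.
[folklore] -/
theorem smul_geomPoints_eq (σ : Field.absoluteGaloisGroup ℚ) (P : geomPoints (shortWeierstrass AB)) :
    σ • P = Point.map ((show AlgebraicClosure ℚ ≃ₐ[ℚ] AlgebraicClosure ℚ from σ) :
      AlgebraicClosure ℚ →ₐ[ℚ] AlgebraicClosure ℚ) P :=
  rfl

variable {AB g t r₀}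

/-- The torsor differences lie in `E_{A,B}(ℚ̄)[2] = geomTorsion _ 2`. [folklore] -/
theorem geomTorsorPt_mem (u v : AlgebraicClosure ℚ) :
    geomTorsorPt AB g t u v ∈ geomTorsion (shortWeierstrass AB) 2 := by
  rw [mem_geomTorsion_two_iff]
  exact torsorPt_add_self (isShortModel_ratCast AB _) _ _ _ _

/-- The cocycle takes values in `E_{A,B}(ℚ̄)[2]`. [folklore] -/
theorem geomCocycleFun_mem (σ : Field.absoluteGaloisGroup ℚ) :
    geomCocycleFun AB g t r₀ σ ∈ geomTorsion (shortWeierstrass AB) 2 :=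
  geomTorsorPt_mem _ _

/-- The cocycle identity on `Γ_ℚ`: `c(στ) = c(σ) + σ • c(τ)`. [cite: Cremona2001, §5 (σ ↦ T_σ is a cocycle)] -/
theorem geomCocycleFun_mul (h : Setup g (AB.1 : ℚ) (AB.2 : ℚ) t)
    (hr₀ : (g.map (algebraMap ℚ (AlgebraicClosure ℚ))).eval r₀ 1 = 0)
    (σ τ : Field.absoluteGaloisGroup ℚ) :
    geomCocycleFun AB g t r₀ (σ * τ) = geomCocycleFun AB g t r₀ σ + σ • geomCocycleFun AB g t r₀ τ := by
  obtain ⟨R⟩ := RootData.nonempty (f := g.map (algebraMap ℚ (AlgebraicClosure ℚ)))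
    (by simpa using h.a_ne)
  rw [smul_geomPoints_eq, geomCocycleFun_eq, geomCocycleFun_eq, geomCocycleFun_eq]
  exact cocycleFun_mul h R hr₀
    ((show AlgebraicClosure ℚ ≃ₐ[ℚ] AlgebraicClosure ℚ from σ) :
      AlgebraicClosure ℚ →ₐ[ℚ] AlgebraicClosure ℚ)
    (show AlgebraicClosure ℚ ≃ₐ[ℚ] AlgebraicClosure ℚ from σ)
    (show AlgebraicClosure ℚ ≃ₐ[ℚ] AlgebraicClosure ℚ from τ) (fun _ ↦ rfl)
    (isShortModel_ratCast AB _)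

/-- The cocycle is continuous for the Krull topology on `Γ_ℚ` and the discrete topology on
`E_{A,B}(ℚ̄)[2]`. [folklore] -/
theorem continuous_geomCocycleFun (h : Setup g (AB.1 : ℚ) (AB.2 : ℚ) t)
    (hr₀ : (g.map (algebraMap ℚ (AlgebraicClosure ℚ))).eval r₀ 1 = 0) :
    Continuous fun σ : Field.absoluteGaloisGroup ℚ ↦
      (⟨geomCocycleFun AB g t r₀ σ, geomCocycleFun_mem σ⟩ : geomTorsion (shortWeierstrass AB) 2) :=
  continuous_apply_root (K := ℚ) (isIntegral_of_eval_eq_zero h.a_ne hr₀)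
    (fun x ↦ (⟨geomTorsorPt AB g t r₀ x, geomTorsorPt_mem r₀ x⟩ : geomTorsion (shortWeierstrass AB) 2))

/-- **The `2`-covering cocycle of a binary quartic** `g` over `ℚ` in the `E_{A,B}`-family with
chosen root `r₀ ∈ ℚ̄`: the continuous `1`-cocycle `σ ↦ T(r₀, σ r₀)` of `Γ_ℚ` with values in the
Galois module `E_{A,B}(ℚ̄)[2]` (an element of `contOneCocycles`, Mathlib's continuous cohomology
through the tree's degree-one API). Cremona 2001, §5; this is the map underlying
Bhargava–Shankar's Lemma 5.2. [cite: Cremona2001, §5 (σ ↦ T_σ represents an element of H¹(Gal(K̄/K), E[2]))] -/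
def selmerCocycle (h : Setup g (AB.1 : ℚ) (AB.2 : ℚ) t)
    (hr₀ : (g.map (algebraMap ℚ (AlgebraicClosure ℚ))).eval r₀ 1 = 0) :
    contOneCocycles (discreteTopRep (Field.absoluteGaloisGroup ℚ)
      (geomTorsion (shortWeierstrass AB) 2)) :=
  ⟨⟨fun σ ↦ ⟨geomCocycleFun AB g t r₀ σ, geomCocycleFun_mem σ⟩, continuous_geomCocycleFun h hr₀⟩,
    fun σ τ ↦ Subtype.ext (by
      rw [discreteTopRep_ρ_apply]
      exact geomCocycleFun_mul h hr₀ σ τ)⟩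

/-- Unfolding `selmerCocycle`: its value at `σ` is `T(r₀, σ r₀)`. [folklore] -/
@[simp] theorem selmerCocycle_apply (h : Setup g (AB.1 : ℚ) (AB.2 : ℚ) t)
    (hr₀ : (g.map (algebraMap ℚ (AlgebraicClosure ℚ))).eval r₀ 1 = 0)
    (σ : Field.absoluteGaloisGroup ℚ) :
    ((selmerCocycle h hr₀).1 σ : geomPoints (shortWeierstrass AB)) = geomCocycleFun AB g t r₀ σ :=
  rfl

/-- **The Selmer class of a binary quartic**: the class `[σ ↦ T(r₀, σ r₀)] ∈ H¹(ℚ, E_{A,B}[2])`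
(the tree's `galH1Torsion _ 2`, Mathlib's continuous cohomology). Bhargava–Shankar, Lemma 5.2;
Cremona 2001, §5. [cite: BhargavaShankarAnnals2015, Lemma 5.2 (arXiv:1006.1002v2 numbering)] -/
def selmerClass (h : Setup g (AB.1 : ℚ) (AB.2 : ℚ) t)
    (hr₀ : (g.map (algebraMap ℚ (AlgebraicClosure ℚ))).eval r₀ 1 = 0) :
    galH1Torsion (shortWeierstrass AB) 2 :=
  oneCocycleClass _ (selmerCocycle h hr₀)

/-- **Independence of the root**: the Selmer classes attached to two roots `r₀, r₁` of `g(x,1)`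
coincide (the cocycles differ by the coboundary of `T(r₀, r₁)`). Cremona 2001, §5.
[cite: Cremona2001, §5 (independence of the choice of θ and R)] -/
theorem selmerClass_changeRoot (h : Setup g (AB.1 : ℚ) (AB.2 : ℚ) t)
    (hr₀ : (g.map (algebraMap ℚ (AlgebraicClosure ℚ))).eval r₀ 1 = 0) {r₁ : AlgebraicClosure ℚ}
    (hr₁ : (g.map (algebraMap ℚ (AlgebraicClosure ℚ))).eval r₁ 1 = 0) :
    selmerClass h hr₁ = selmerClass h hr₀ := by
  rw [selmerClass, selmerClass, ← sub_eq_zero, ← oneCocycleClass_sub, oneCocycleClass_eq_zero_iff]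
  obtain ⟨R⟩ := RootData.nonempty (f := g.map (algebraMap ℚ (AlgebraicClosure ℚ)))
    (by simpa using h.a_ne)
  refine ⟨⟨geomTorsorPt AB g t r₀ r₁, geomTorsorPt_mem r₀ r₁⟩, fun σ ↦ Subtype.ext ?_⟩
  rw [discreteTopRep_ρ_apply]
  change geomCocycleFun AB g t r₁ σ - geomCocycleFun AB g t r₀ σ =
    σ • geomTorsorPt AB g t r₀ r₁ - geomTorsorPt AB g t r₀ r₁
  have key : geomCocycleFun AB g t r₁ σ = geomCocycleFun AB g t r₀ σ +
      (σ • geomTorsorPt AB g t r₀ r₁ - geomTorsorPt AB g t r₀ r₁) :=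
    cocycleFun_changeRoot h R hr₀ hr₁
      ((show AlgebraicClosure ℚ ≃ₐ[ℚ] AlgebraicClosure ℚ from σ) :
        AlgebraicClosure ℚ →ₐ[ℚ] AlgebraicClosure ℚ)
      (show AlgebraicClosure ℚ ≃ₐ[ℚ] AlgebraicClosure ℚ from σ) (fun _ ↦ rfl)
      (isShortModel_ratCast AB _)
  rw [key]
  abel

/-- The cocycle of `g` over a `ℚ`-field `E` (a completion), with root `ρ ∈ Ē`, valued in the
tree's local Galois module `localPoints (shortWeierstrass AB) E = E_{A,B}(Ē)`. [folklore] -/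
def localCocycleFun (AB : ℤ × ℤ) (g : BinaryQuartic ℚ) (t : ℚ) (E : Type) [Field E] [Algebra ℚ E]
    (ρ : AlgebraicClosure E) (σ : Field.absoluteGaloisGroup E) : localPoints (shortWeierstrass AB) E :=
  cocycleFun (shortWeierstrass AB) (g.map (algebraMap ℚ E)) (algebraMap ℚ E t) ρ
    (show AlgebraicClosure E ≃ₐ[E] AlgebraicClosure E from σ)

/-- Unfolding `localCocycleFun`. [folklore] -/
theorem localCocycleFun_eq (AB : ℤ × ℤ) (g : BinaryQuartic ℚ) (t : ℚ) (E : Type) [Field E]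
    [Algebra ℚ E] (ρ : AlgebraicClosure E) (σ : Field.absoluteGaloisGroup E) :
    localCocycleFun AB g t E ρ σ =
    cocycleFun (shortWeierstrass AB) (g.map (algebraMap ℚ E)) (algebraMap ℚ E t) ρ
      (show AlgebraicClosure E ≃ₐ[E] AlgebraicClosure E from σ) := rfl

/-- Pulling the global cocycle back along the chosen embedding `ι : ℚ̄ → Ē` and `Γ_E → Γ_ℚ` gives
the local cocycle with root `ι r₀` (functoriality of `T` and `ι ∘ σ|_ℚ̄ = σ ∘ ι`).
Serre, *Galois Cohomology*, I.§2.4 (compatible pairs). [folklore] -/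
theorem pointsMap_geomCocycleFun (E : Type) [Field E] [Algebra ℚ E] (σ : Field.absoluteGaloisGroup E) :
    pointsMap (shortWeierstrass AB) E (geomCocycleFun AB g t r₀ (resGal (K := ℚ) E σ)) =
      localCocycleFun AB g t E (closureEmb (K := ℚ) E r₀) σ := by
  rw [geomCocycleFun_eq, localCocycleFun_eq, cocycleFun_apply, cocycleFun_apply]
  change Point.map (closureEmb (K := ℚ) E) (torsorPt _ _ _ _ _) = _
  rw [map_torsorPt]
  congr 1
  · ext <;> simp [BinaryQuartic.map]
  · simp
  · exact apply_resGalAuxOfEmb_apply (closureEmb (K := ℚ) E) σ r₀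

/-- **Cocycle form of the local condition.** For a `ℚ`-field `E` (a completion `ℚ_v`), the Selmer
class of `g` lies in the local kernel `ker (H¹(ℚ, E[2]) → H¹(E, E_{A,B}(Ē)))` iff the cocycle of
`g` formed over `E` with the root `ι r₀` (`ι = closureEmb E : ℚ̄ → Ē` the chosen embedding) is
principal: `∃ P ∈ E_{A,B}(Ē), ∀ σ ∈ Γ_E, T(ι r₀, σ ι r₀) = σP − P` (Serre, *Galois Cohomology*,
I.§5.1; Cremona 2001 §5: the class becomes trivial in `H¹(Gal(K̄/K), E)` iff it is a coboundary
`Q^σ − Q`). [cite: Cremona2001, §5 (cocycles trivial in H¹(Gal(K̄/K), E) as coboundaries Q^σ − Q)] -/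
theorem selmerClass_mem_selmerLocalKer_iff (h : Setup g (AB.1 : ℚ) (AB.2 : ℚ) t)
    (hr₀ : (g.map (algebraMap ℚ (AlgebraicClosure ℚ))).eval r₀ 1 = 0)
    (E : Type) [Field E] [Algebra ℚ E] :
    selmerClass h hr₀ ∈ selmerLocalKer (shortWeierstrass AB) E 2 ↔
      ∃ P : localPoints (shortWeierstrass AB) E, ∀ σ : Field.absoluteGaloisGroup E,
        localCocycleFun AB g t E (closureEmb (K := ℚ) E r₀) σ = σ • P - P := by
  rw [selmerClass, selmerLocalKer, oneCocycleClass_mem_resKer_iff]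
  refine exists_congr fun P ↦ forall_congr' fun σ ↦ ?_
  rw [AddMonoidHom.comp_apply, AddSubgroup.coe_subtype, selmerCocycle_apply,
    pointsMap_geomCocycleFun]

end Rat


end TwoCovering

end Literature.NumberTheory.EllipticCurves
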